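import Literature.Analysis.PDE.TorusQuasilinearScheme
import Literature.Analysis.PDE.TorusUnifWords
import Literature.Analysis.PDE.WordUniformLimits
import HarnessLib

/-!
# Local classical solutions of quasilinear symmetric hyperbolic systems on `𝕋³` (and on `𝕋ⁿ`
# at a generic Sobolev margin): the limit of the Picard scheme (topic `Analysis/PDE`)

Analysis/PDE support file (everything proved; no definitions, no named facts): the last step of
the energy method for quasilinear symmetric hyperbolic systems `A₀(U)∂ₜU + ΣⱼAⱼ(U)∂ⱼU = 0` on
the flat torus `𝕋³` with smooth data (Dafermos 2005, Thm 5.1.1; Majda 1984, Ch. 2, Thm 2.1),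
towards the named fact `Literature.MathematicalPhysics.KineticTheory.hsEuler_localExistence`.

Given symmetrised coefficient data `IsQLSymmCoeff c₀ Λ₀ a0 a p q` (`TorusQuasilinearAPriori`)
and a smooth datum `U₀`, the Picard scheme `Uᵏ` of `TorusQuasilinearScheme` (run forward and,
through time reversal, backward) converges on `[-T, T] × 𝕋³` uniformly with all spatial
derivatives (`scheme_uniformly_cauchy`); by the equations `∂ₜUᵏ⁺¹ = -Σⱼãⱼ(Uᵏ)∂ⱼUᵏ⁺¹` and the
closure properties of `TorusUnifWords` the same holds for all mixed space–time derivatives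
(`IsQLSymmCoeff.scheme_inB`); the limits of the word derivatives then form a family to which
`contDiffOn_of_word_partials` (`WordUniformLimits`) applies, so the limit `U` is jointly `C^∞`
on `(-T, T) × 𝕋³`, and passing to the limit pointwise in the scheme gives the equation:

* `IsQLSymmCoeff.exists_smooth_solution` — **Majda's Theorem 2.1 on `𝕋³` in the `C^∞` class**:
  there are `T > 0` and `U` jointly smooth on `(-T, T) × 𝕋³` with `U(0) = U₀` and
  `A₀(U)∂ₜU + ΣⱼAⱼ(U)∂ⱼU = 0`.

Generic dimension and Sobolev margin: the same chain is proved first on `𝕋^ι` for any finite `ι`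
(`cwd_iterate_cauchy_of_inB`, `IsQLSymmCoeff.schemeGen_timeDeriv_succ`,
`IsQLSymmCoeff.schemeGen_inB`, over the scheme structure `IsSchemeGen` of `TorusQuasilinearScheme`)
and on `𝕋ⁿ` for every `n` under the word-form sup embedding HYPOTHESIS
`hS : Torus.WordSupEmbedding (Fin n) σ` (`‖f x‖² ≤ C_s · twordEnergy σ f`):
`IsQLSymmCoeff.exists_scheme_unifWords_of_wordSup` and
`IsQLSymmCoeff.exists_smooth_solution_of_wordSup` — **Majda's Theorem 2.1 on `𝕋ⁿ` in the `C^∞`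
class** (Majda 1984, Ch. 2 §2.1: the energy method in any number of space variables once
`H^σ ⊂ L^∞`, `2σ > n`); the `𝕋³` statements above are their `ι = Fin 3`, `σ = 2` instances through
`Torus.wordSupEmbedding_fin3_two` and the conversions `IsScheme.isSchemeGen` /
`IsSchemeGen.isScheme`. With `Torus.wordSupEmbedding_fin4_three` (`σ = 3`) this is local `C^∞`
existence on `𝕋⁴`, and with `Torus.wordSupEmbedding_fin` (`σ = n + 1`) on `𝕋ⁿ` for every `n`.

## Mathlib / tree search

Tree: `TorusQuasilinearScheme` (`IsScheme`, `exists_scheme`, `scheme_uniformly_cauchy`,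
`IsScheme.reverse`; generic forms `IsSchemeGen`, `exists_schemeGen`,
`scheme_uniformly_cauchy_of_wordSup`, `IsSchemeGen.reverse`, conversions `IsScheme.isSchemeGen` /
`IsSchemeGen.isScheme`), `Torus.WordSupEmbedding`, `Torus.wordSupEmbedding_fin3_two`
(`FunctionSpaces/TorusWordSupEmbedding`), `TorusUnifWords` (`UnifWords`, `InB`), `WordUniformLimits`
(`exists_limit_of_uniformly_cauchy_cwd`, `contDiffOn_of_word_partials`,
`hasDerivAt_of_uniform_approx`), `TorusWordCalculus` (dictionary). Mathlib:
`tendsto_nhds_unique`, `TendstoUniformlyOn.continuousOn`, `isBoundedBilinearMap_apply`.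

## References

* A. Majda, *Compressible Fluid Flow and Systems of Conservation Laws in Several Space
  Variables*, Springer 1984, Ch. 2 §2.1, Thm 2.1 and its proof, Step 3. [`Majda1984`]
* C. M. Dafermos, *Hyperbolic Conservation Laws in Continuum Physics*, 2nd ed., Springer 2005,
  §5.1, Thm 5.1.1, (5.1.25)–(5.1.26). [`Dafermos2005`]
* T. Kato, Arch. Rational Mech. Anal. 58 (1975) 181–205, Thm II. [`Kato1975`]
-/

noncomputable section

open Set Filter Function
open scoped ContDiff Topology InnerProductSpace

namespace Literature.Analysis.PDE

open Literature.Analysis.FunctionSpaces Literature.Analysis.FunctionSpaces.Torus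

universe u

variable {W : Type u} [NormedAddCommGroup W] [InnerProductSpace ℝ W] [CompleteSpace W]
  [FiniteDimensional ℝ W]

/-! ## Small tools -/

omit [InnerProductSpace ℝ W] [CompleteSpace W] [FiniteDimensional ℝ W] in
/-- Joint continuity of evaluation along convergent sequences of operators and vectors.
[folklore] -/
theorem tendsto_clm_apply_of_tendsto {W' : Type*} [NormedAddCommGroup W'] [NormedSpace ℝ W']
    {A : ℕ → W' →L[ℝ] W'} {v : ℕ → W'} {Al : W' →L[ℝ] W'} {vl : W'}
    (hA : Tendsto A atTop (𝓝 Al)) (hv : Tendsto v atTop (𝓝 vl)) :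
    Tendsto (fun k => A k (v k)) atTop (𝓝 (Al vl)) :=
  ((isBoundedBilinearMap_apply (𝕜 := ℝ) (E := W') (F := W')).continuous.tendsto (Al, vl)).comp
    (hA.prodMk_nhds hv)

/-! ## The limit in any number of space variables, at a generic Sobolev margin -/

section LimitGen

variable {ι : Type*} [Fintype ι] [DecidableEq ι]
variable {c₀ Λ₀ : ℝ} {a0 : W → (W →L[ℝ] W)} {a : ι → W → (W →L[ℝ] W)} {p q : W → (W →L[ℝ] W)}
variable {U₀ : UnitAddTorus ι → W} {U : ℕ → ℝ → UnitAddTorus ι → W}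

omit [CompleteSpace W] [FiniteDimensional ℝ W] in
/-- The word derivatives of the iterated time derivatives `∂ₜˡFᵏ` of a sequence of fields on
`ℝ × 𝕋^ι` lying in all classes `InB T l` (Majda, proof of Thm 2.1, Step 3: uniform convergence of
all mixed derivatives; Dafermos (5.1.25)–(5.1.26)) are uniformly Cauchy on `[-T, T]` in the lifted
(`cwd`) picture, for any finite set of directions `ι`. The `𝕋³` case is
`IsQLSymmCoeff.cwd_cauchy_of_inB`.
[cite: Majda1984, Ch. 2 §2.1, proof of Thm 2.1, Step 3; Dafermos2005, §5.1 (5.1.25)–(5.1.26)] -/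
theorem cwd_iterate_cauchy_of_inB {T : ℝ} (hB : ∀ l, InB T l U) (l : ℕ) :
    ∀ v : List ι, ∀ ε > (0 : ℝ), ∃ N : ℕ, ∀ k, N ≤ k → ∀ k', N ≤ k' → ∀ τ ∈ Icc (-T) T, ∀ y,
      ‖cwd v (lift ((timeDeriv^[l]) (U k) τ)) y - cwd v (lift ((timeDeriv^[l]) (U k') τ)) y‖ ≤ ε := by
  intro v ε hε
  have hZ := (hB l).iterate l le_rfl
  obtain ⟨N, hN⟩ := hZ.cauchy v hε
  refine ⟨N, fun k hk k' hk' τ hτ y => ?_⟩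
  rw [← iterPartialDeriv_apply_proj (hZ.isSmooth k τ), ← iterPartialDeriv_apply_proj (hZ.isSmooth k' τ)]
  exact hN k hk k' hk' τ hτ (proj y)

namespace IsQLSymmCoeff

/-! ### A scheme on `𝕋^ι` is in the class `InB T l` for every `l` -/

omit [CompleteSpace W] in
/-- The equations of a scheme on `𝕋^ι` solved for the time derivative:
`∂ₜUᵏ⁺¹ = -Σⱼ ãⱼ(Uᵏ) ∂ⱼUᵏ⁺¹` (any finite set of directions `ι`; the `𝕋³` case is
`scheme_timeDeriv_succ`). [cite: Majda1984, Ch. 2 §2.1, proof of Thm 2.1, Step 3] -/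
theorem schemeGen_timeDeriv_succ (h : IsQLSymmCoeff c₀ Λ₀ a0 a p q) (hs : IsSchemeGen a0 a U₀ U)
    (k : ℕ) :
    timeDeriv (U (k + 1)) = fun t x =>
      -∑ j, qlATil a p q j (U k t x) (partialDeriv j (U (k + 1) t) x) :=
  funext fun t => funext fun x => h.timeDeriv_eq (hs.eqn k) t x

omit [CompleteSpace W] in
/-- **All mixed derivatives of a scheme on `𝕋^ι` converge uniformly** as soon as the spatial
ones do: a scheme in `UnifWords T` is in `InB T l` for every `l` (any finite set of directions
`ι`; the `𝕋³` case is `scheme_inB`). [cite: Majda1984, Ch. 2 §2.1, proof of Thm 2.1, Step 3] -/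
theorem schemeGen_inB (h : IsQLSymmCoeff c₀ Λ₀ a0 a p q) (hs : IsSchemeGen a0 a U₀ U) {T : ℝ}
    (hU : UnifWords T U) : ∀ l : ℕ, InB T l U
  | 0 => hU
  | l + 1 => by
    have ih := schemeGen_inB h hs hU l
    refine ⟨ih, ?_⟩
    refine InB.of_shift (isSmoothSpaceTimeOn_timeDeriv (hs.smooth 0)) ?_
    have e : (fun k => timeDeriv (U (k + 1))) = fun k t x =>
        -∑ j, (ContinuousLinearMap.id ℝ (W →L[ℝ] W)) (qlATil a p q j (U k t x))
          (partialDeriv j (U (k + 1) t) x) := by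
      funext k
      rw [h.schemeGen_timeDeriv_succ hs k]
      rfl
    rw [e]
    refine InB.neg (InB.sum Finset.univ fun j _ => ?_)
    exact InB.bilin (ContinuousLinearMap.id ℝ (W →L[ℝ] W))
      (InB.comp l (h.contDiff_qlATil j) ih) ((InB.shift ih).partialDeriv j)

end IsQLSymmCoeff

end LimitGen

section LimitGenFin

variable {n : ℕ}
variable {c₀ Λ₀ : ℝ} {a0 : W → (W →L[ℝ] W)} {a : Fin n → W → (W →L[ℝ] W)} {p q : W → (W →L[ℝ] W)}
variable {U₀ : UnitAddTorus (Fin n) → W}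

namespace IsQLSymmCoeff

/-! ### The two-sided uniformly Cauchy scheme and its `C^∞` limit on `𝕋ⁿ` (generic margin) -/

/-- **A scheme on `𝕋ⁿ` uniformly Cauchy with all spatial derivatives on a two-sided time
interval, at a generic Sobolev margin `σ`** (existence on `𝕋ⁿ` by `exists_schemeGen`; forward
and time-reversed estimates `scheme_uniformly_cauchy_of_wordSup` under the word-form sup embedding
`hS : WordSupEmbedding (Fin n) σ`). The `𝕋³` case `σ = 2` is `exists_scheme_unifWords`.
[cite: Majda1984, Ch. 2 §2.1, Thm 2.1 (2.13)–(2.14); Dafermos2005, §5.1 (5.1.25)] -/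
theorem exists_scheme_unifWords_of_wordSup {σ : ℕ} (hS : WordSupEmbedding.{u, _} (Fin n) σ)
    (h : IsQLSymmCoeff c₀ Λ₀ a0 a p q) (hU₀ : IsSmooth U₀) :
    ∃ T : ℝ, 0 < T ∧ ∃ U : ℕ → ℝ → UnitAddTorus (Fin n) → W,
      IsSchemeGen a0 a U₀ U ∧ UnifWords T U := by
  obtain ⟨U, hs⟩ := h.exists_schemeGen hU₀
  obtain ⟨T₁, hT₁, H₁⟩ := h.scheme_uniformly_cauchy_of_wordSup (U₀ := U₀) hS
  obtain ⟨T₂, hT₂, H₂⟩ := h.neg.scheme_uniformly_cauchy_of_wordSup (U₀ := U₀) hS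
  have h₁ := (H₁ U hs).2
  have h₂ := (H₂ _ hs.reverse).2
  refine ⟨min T₁ T₂, lt_min hT₁ hT₂, U, hs, hs.smooth, fun w ε hε => ?_⟩
  obtain ⟨N₁, hN₁⟩ := h₁ w ε hε
  obtain ⟨N₂, hN₂⟩ := h₂ w ε hε
  refine ⟨max N₁ N₂, fun k hk l hl t ht x => ?_⟩
  rcases le_or_gt 0 t with ht0 | ht0
  · exact hN₁ k ((le_max_left _ _).trans hk) l ((le_max_left _ _).trans hl) t
      ⟨ht0, ht.2.trans (min_le_left _ _)⟩ x
  · have ht' : -t ∈ Icc 0 T₂ := ⟨by linarith, by linarith [ht.1, min_le_right T₁ T₂]⟩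
    have := hN₂ k ((le_max_right _ _).trans hk) l ((le_max_right _ _).trans hl) (-t) ht' x
    simpa only [neg_neg] using this

/-- **Majda's Theorem 2.1 on `𝕋ⁿ` in the `C^∞` class, every `n`, at a generic Sobolev margin**
(Majda 1984, Thm 2.1, stated in any number of space variables for `s > n/2 + 1`; Dafermos,
Thm 5.1.1; Kato 1975, Thm II): under a word-form sup embedding `hS : WordSupEmbedding (Fin n) σ`
(`H^σ(𝕋ⁿ) ⊂ L^∞`, available for `n < 2σ` by `Torus.wordSupEmbedding_fin`), for symmetrised
quasilinear coefficient data and a smooth datum `U₀` there are `T > 0` and a field `U` jointly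
`C^∞` on `(-T, T) × 𝕋ⁿ` with `U(0) = U₀` solving `A₀(U)∂ₜU + ΣⱼAⱼ(U)∂ⱼU = 0` classically (the
two-sided uniformly Cauchy scheme `exists_scheme_unifWords_of_wordSup`, uniform convergence of all
mixed derivatives `schemeGen_inB`, the `C^∞` limit by `contDiffOn_of_word_partials`, and the
pointwise limit in the scheme). The `𝕋³` case `σ = 2` is `exists_smooth_solution`.
[cite: Majda1984, Ch. 2 §2.1, Thm 2.1; Dafermos2005, §5.1, Thm 5.1.1; Kato1975, Thm II] -/
theorem exists_smooth_solution_of_wordSup {σ : ℕ} (hS : WordSupEmbedding.{u, _} (Fin n) σ)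
    (h : IsQLSymmCoeff c₀ Λ₀ a0 a p q) (hU₀ : IsSmooth U₀) :
    ∃ T : ℝ, 0 < T ∧ ∃ V : ℝ → UnitAddTorus (Fin n) → W,
      IsSmoothSpaceTimeOn (Ioo (-T) T) V ∧ V 0 = U₀ ∧
      ∀ t ∈ Ioo (-T) T, ∀ x,
        a0 (V t x) (timeDeriv V t x) + ∑ j, a j (V t x) (partialDeriv j (V t) x) = 0 := by
  obtain ⟨T, hT, U, hs, hUW⟩ := h.exists_scheme_unifWords_of_wordSup hS hU₀
  have hB : ∀ l, InB T l U := h.schemeGen_inB hs hUW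
  set S : Set ℝ := Icc (-T) T with hS_eq
  set I : Set ℝ := Ioo (-T) T with hI
  have hIS : I ⊆ S := Ioo_subset_Icc_self
  have hIo : IsOpen I := isOpen_Ioo
  -- the iterated time derivatives and their smoothness
  set Z : ℕ → ℕ → ℝ → UnitAddTorus (Fin n) → W := fun l k => (timeDeriv^[l]) (U k) with hZ
  have hZW : ∀ l, UnifWords T (Z l) := fun l => (hB l).iterate l le_rfl
  have hZs : ∀ l k, IsSmoothSpaceTimeOn univ (Z l k) := fun l k => (hZW l).smooth k
  have hZsucc : ∀ l k, timeDeriv (Z l k) = Z (l + 1) k := fun l k => by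
    simp only [hZ, Function.iterate_succ_apply']
  -- limits of all word derivatives of all `Z l`
  have hf : ∀ l k (τ : ℝ), ContDiff ℝ ∞ (lift (Z l k τ)) := fun l k τ => (hZW l).isSmooth k τ
  choose g hg₁ hg₂ hg₃ using fun l =>
    exists_limit_of_uniformly_cauchy_cwd (F := W) S (hf l) (cwd_iterate_cauchy_of_inB hB l)
  -- the family `G l v (τ, y) := g l v τ y` and its joint smoothness on `I × ℝⁿ`
  have hder : ∀ l v k (y : EuclideanSpace ℝ (Fin n)) (τ : ℝ),
      HasDerivAt (fun s => cwd v (lift (Z l k s)) y) (cwd v (lift (Z (l + 1) k τ)) y) τ := by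
    intro l v k y τ
    have h1 := hasDerivAt_slice_of_univ' (isSmoothSpaceTimeOn_iterPartialDeriv (hZs l k) uniqueDiffOn_univ v)
      τ (proj y)
    rw [timeDeriv_iterPartialDeriv_comm (hZs l k) v τ (proj y), hZsucc] at h1
    have e1 : (fun s => iterPartialDeriv v (Z l k s) (proj y)) = fun s => cwd v (lift (Z l k s)) y :=
      funext fun s => iterPartialDeriv_apply_proj ((hZW l).isSmooth k s) v y
    rw [e1, iterPartialDeriv_apply_proj ((hZW (l + 1)).isSmooth k τ)] at h1
    exact h1
  have ht : ∀ l v, ∀ pt ∈ I ×ˢ (univ : Set (EuclideanSpace ℝ (Fin n))),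
      HasDerivAt (fun τ => g l v τ pt.2) (g (l + 1) v pt.1 pt.2) pt.1 := by
    intro l v pt hpt
    refine hasDerivAt_of_uniform_approx hIo (φ := fun k τ => cwd v (lift (Z l k τ)) pt.2)
      (ψ := fun k τ => cwd v (lift (Z (l + 1) k τ)) pt.2) (φl := fun τ => g l v τ pt.2)
      (ψl := fun τ => g (l + 1) v τ pt.2) (fun k τ _ => hder l v k pt.2 τ)
      (fun ε hε => ?_) (fun τ hτ => hg₂ l v τ (hIS hτ) pt.2) hpt.1
    obtain ⟨N, hN⟩ := hg₁ (l + 1) v ε hε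
    exact ⟨N, fun k hk τ hτ => hN k hk τ (hIS hτ) pt.2⟩
  have hy : ∀ l v, ∀ pt ∈ I ×ˢ (univ : Set (EuclideanSpace ℝ (Fin n))),
      HasFDerivAt (fun y => g l v pt.1 y)
        (∑ i, (EuclideanSpace.proj i : EuclideanSpace ℝ (Fin n) →L[ℝ] ℝ).smulRight (g l (i :: v) pt.1 pt.2)) pt.2 :=
    fun l v pt hpt => hg₃ l v pt.1 (hIS hpt.1) pt.2
  have hc : ∀ l v, ContinuousOn (fun pt : ℝ × EuclideanSpace ℝ (Fin n) => g l v pt.1 pt.2) (I ×ˢ univ) := by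
    intro l v
    have hcont : ∀ k, Continuous fun pt : ℝ × EuclideanSpace ℝ (Fin n) => cwd v (lift (Z l k pt.1)) pt.2 := by
      intro k
      have h1 := (isSmoothSpaceTimeOn_iterPartialDeriv (hZs l k) uniqueDiffOn_univ v).continuousOn_stLift
      have h2 : Continuous (stLift fun s => iterPartialDeriv v (Z l k s)) := by
        rw [← continuousOn_univ]; simpa only [univ_prod_univ] using h1
      refine h2.congr fun pt => ?_
      show iterPartialDeriv v (Z l k pt.1) (proj pt.2) = _
      exact iterPartialDeriv_apply_proj ((hZW l).isSmooth k pt.1) v pt.2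
    have hunif : TendstoUniformlyOn (fun k (pt : ℝ × EuclideanSpace ℝ (Fin n)) => cwd v (lift (Z l k pt.1)) pt.2)
        (fun pt => g l v pt.1 pt.2) atTop (S ×ˢ univ) := by
      refine Metric.tendstoUniformlyOn_iff.2 fun ε hε => ?_
      obtain ⟨N, hN⟩ := hg₁ l v (ε / 2) (half_pos hε)
      refine eventually_atTop.2 ⟨N, fun k hk pt hpt => ?_⟩
      rw [dist_comm, dist_eq_norm]
      exact (hN k hk pt.1 hpt.1 pt.2).trans_lt (half_lt_self hε)
    exact (hunif.continuousOn (Eventually.of_forall fun k => (hcont k).continuousOn).frequently).mono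
      (prod_mono hIS Subset.rfl)
  have hG : ∀ l v, ContDiffOn ℝ ∞ (fun pt : ℝ × EuclideanSpace ℝ (Fin n) => g l v pt.1 pt.2) (I ×ˢ univ) :=
    fun l v => contDiffOn_of_word_partials (G := fun l v pt => g l v pt.1 pt.2) hIo hy ht hc l v
  -- the limit field
  set V : ℝ → UnitAddTorus (Fin n) → W := fun t x => limUnder atTop fun k => U k t x with hV
  have hUk : ∀ k t (y : EuclideanSpace ℝ (Fin n)), cwd [] (lift (Z 0 k t)) y = U k t (proj y) := by
    intro k t y; rfl
  have hVlim : ∀ t ∈ S, ∀ x, Tendsto (fun k => U k t x) atTop (𝓝 (V t x)) := by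
    intro t ht x
    have h1 := hg₂ 0 [] t ht (repr x)
    simp only [hUk, proj_repr] at h1
    exact tendsto_nhds_limUnder ⟨_, h1⟩
  have hVg : ∀ t ∈ S, ∀ y, g 0 [] t y = V t (proj y) := by
    intro t ht y
    have h1 := hg₂ 0 [] t ht y
    simp only [hUk] at h1
    exact tendsto_nhds_unique h1 (hVlim t ht (proj y))
  refine ⟨T, hT, V, ?_, ?_, ?_⟩
  · -- joint smoothness
    show ContDiffOn ℝ ∞ (stLift V) (I ×ˢ univ)
    refine (hG 0 []).congr fun pt hpt => ?_
    show V pt.1 (proj pt.2) = g 0 [] pt.1 pt.2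
    rw [hVg pt.1 (hIS hpt.1)]
  · -- initial datum
    funext x
    have h0 : (0 : ℝ) ∈ S := ⟨by linarith, hT.le⟩
    have h1 := hVlim 0 h0 x
    have h2 : Tendsto (fun k => U k 0 x) atTop (𝓝 (U₀ x)) := by
      simp only [hs.init]; exact tendsto_const_nhds
    exact tendsto_nhds_unique h1 h2
  · -- the equation
    intro t htI x
    have htS : t ∈ S := hIS htI
    -- convergence of the ingredients at `(t, x)`
    have c0 : Tendsto (fun k => U k t x) atTop (𝓝 (V t x)) := hVlim t htS x
    have c1 : Tendsto (fun k => timeDeriv (U k) t x) atTop (𝓝 (timeDeriv V t x)) := by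
      have hd1 : HasDerivAt (fun τ => g 0 [] τ (repr x)) (g 1 [] t (repr x)) t :=
        ht 0 [] (t, repr x) ⟨htI, mem_univ _⟩
      have hd2 : HasDerivAt (fun τ => V τ x) (g 1 [] t (repr x)) t := by
        refine hd1.congr_of_eventuallyEq ?_
        filter_upwards [hIo.mem_nhds htI] with τ hτ
        rw [hVg τ (hIS hτ), proj_repr]
      rw [show timeDeriv V t x = g 1 [] t (repr x) from hd2.deriv]
      have h1 := hg₂ 1 [] t htS (repr x)
      have e : ∀ k, cwd [] (lift (Z 1 k t)) (repr x) = timeDeriv (U k) t x := fun k => by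
        show (timeDeriv^[1]) (U k) t (proj (repr x)) = _
        rw [proj_repr]; rfl
      simpa only [e] using h1
    have c2 : ∀ j, Tendsto (fun k => partialDeriv j (U k t) x) atTop (𝓝 (partialDeriv j (V t) x)) := by
      intro j
      have hVt : IsSmooth (V t) := by
        have : ContDiffOn ℝ ∞ (stLift V) (I ×ˢ univ) := by
          refine (hG 0 []).congr fun pt hpt => ?_
          show V pt.1 (proj pt.2) = g 0 [] pt.1 pt.2
          rw [hVg pt.1 (hIS hpt.1)]
        exact IsSmoothSpaceTimeOn.isSmooth_slice this htI
      have hfd : HasFDerivAt (lift (V t))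
          (∑ i, (EuclideanSpace.proj i : EuclideanSpace ℝ (Fin n) →L[ℝ] ℝ).smulRight (g 0 [i] t (repr x)))
          (repr x) := by
        have e : lift (V t) = g 0 [] t := funext fun y => by rw [lift_apply, hVg t htS y]
        rw [e]; exact hg₃ 0 [] t htS (repr x)
      have e1 : partialDeriv j (V t) x = g 0 [j] t (repr x) := by
        have h1 := congr_fun (lift_partialDeriv_eq_cwd (hVt.of_le (by exact_mod_cast le_top)) j) (repr x)
        rw [lift_apply, proj_repr] at h1
        rw [h1, cwd_singleton]
        show fderiv ℝ (lift (V t)) (repr x) (bv j) = _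
        rw [hfd.fderiv]
        have hpi : ∀ i, (EuclideanSpace.proj i : EuclideanSpace ℝ (Fin n) →L[ℝ] ℝ) (bv j) =
            if i = j then 1 else 0 := fun i => by
          rw [bv_eq_single]; simp
        simp only [FunLike.coe_sum, Finset.sum_apply, ContinuousLinearMap.smulRight_apply]
        simp_rw [hpi, ite_smul, one_smul, zero_smul, Finset.sum_ite_eq', Finset.mem_univ, if_true]
      rw [e1]
      have h1 := hg₂ 0 [j] t htS (repr x)
      have e : ∀ k, cwd [j] (lift (Z 0 k t)) (repr x) = partialDeriv j (U k t) x := fun k => by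
        show cwd [j] (lift (U k t)) (repr x) = _
        rw [← iterPartialDeriv_apply_proj (hs.isSmooth k t) [j] (repr x), proj_repr]
        rfl
      simpa only [e] using h1
    -- pass to the limit in the scheme
    have cA0 : Tendsto (fun k => a0 (U k t x)) atTop (𝓝 (a0 (V t x))) :=
      (h.smooth₀.continuous.tendsto _).comp c0
    have cA : ∀ j, Tendsto (fun k => a j (U k t x)) atTop (𝓝 (a j (V t x))) := fun j =>
      ((h.smooth j).continuous.tendsto _).comp c0
    have c1' : Tendsto (fun k => timeDeriv (U (k + 1)) t x) atTop (𝓝 (timeDeriv V t x)) :=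
      c1.comp (tendsto_add_atTop_nat 1)
    have c2' : ∀ j, Tendsto (fun k => partialDeriv j (U (k + 1) t) x) atTop (𝓝 (partialDeriv j (V t) x)) :=
      fun j => (c2 j).comp (tendsto_add_atTop_nat 1)
    have hlim : Tendsto (fun k => a0 (U k t x) (timeDeriv (U (k + 1)) t x) +
        ∑ j, a j (U k t x) (partialDeriv j (U (k + 1) t) x)) atTop
        (𝓝 (a0 (V t x) (timeDeriv V t x) + ∑ j, a j (V t x) (partialDeriv j (V t) x))) :=
      (tendsto_clm_apply_of_tendsto cA0 c1').add
        (tendsto_finsetSum _ fun j _ => tendsto_clm_apply_of_tendsto (cA j) (c2' j))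
    have hzero : (fun k => a0 (U k t x) (timeDeriv (U (k + 1)) t x) +
        ∑ j, a j (U k t x) (partialDeriv j (U (k + 1) t) x)) = fun _ => 0 :=
      funext fun k => hs.eqn k t x
    rw [hzero] at hlim
    exact (tendsto_nhds_unique hlim tendsto_const_nhds).symm ▸ rfl

end IsQLSymmCoeff

end LimitGenFin

/-! ## The `𝕋³` statements (`ι = Fin 3`, Sobolev margin `σ = 2`) -/

section Limit

variable {c₀ Λ₀ : ℝ} {a0 : W → (W →L[ℝ] W)} {a : Fin 3 → W → (W →L[ℝ] W)} {p q : W → (W →L[ℝ] W)}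
variable {U₀ : UnitAddTorus (Fin 3) → W} {U : ℕ → ℝ → UnitAddTorus (Fin 3) → W}

namespace IsQLSymmCoeff

/-! ## The scheme is in the class `InB T l` for every `l` -/

omit [CompleteSpace W] in
/-- The equations of the scheme solved for the time derivative:
`∂ₜUᵏ⁺¹ = -Σⱼ ãⱼ(Uᵏ) ∂ⱼUᵏ⁺¹`. [cite: Majda1984, Ch. 2 §2.1, proof of Thm 2.1, Step 3] -/
theorem scheme_timeDeriv_succ (h : IsQLSymmCoeff c₀ Λ₀ a0 a p q) (hs : IsScheme a0 a U₀ U) (k : ℕ) :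
    timeDeriv (U (k + 1)) = fun t x =>
      -∑ j, qlATil a p q j (U k t x) (partialDeriv j (U (k + 1) t) x) :=
  h.schemeGen_timeDeriv_succ hs.isSchemeGen k

omit [CompleteSpace W] in
/-- **All mixed derivatives of the scheme converge uniformly** as soon as the spatial ones do:
a scheme in `UnifWords T` is in `InB T l` for every `l`.
[cite: Majda1984, Ch. 2 §2.1, proof of Thm 2.1, Step 3] -/
theorem scheme_inB (h : IsQLSymmCoeff c₀ Λ₀ a0 a p q) (hs : IsScheme a0 a U₀ U) {T : ℝ}
    (hU : UnifWords T U) : ∀ l : ℕ, InB T l U :=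
  h.schemeGen_inB hs.isSchemeGen hU

/-- **A scheme uniformly Cauchy with all spatial derivatives on a two-sided time interval**
(forward and time-reversed estimates). [cite: Majda1984, Ch. 2 §2.1, Thm 2.1 (2.13)–(2.14)] -/
theorem exists_scheme_unifWords (h : IsQLSymmCoeff c₀ Λ₀ a0 a p q) (hU₀ : IsSmooth U₀) :
    ∃ T : ℝ, 0 < T ∧ ∃ U : ℕ → ℝ → UnitAddTorus (Fin 3) → W, IsScheme a0 a U₀ U ∧ UnifWords T U := by
  obtain ⟨T, hT, U, hs, hU⟩ := h.exists_scheme_unifWords_of_wordSup wordSupEmbedding_fin3_two hU₀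
  exact ⟨T, hT, U, hs.isScheme, hU⟩

/-! ## The limit -/

omit [CompleteSpace W] [FiniteDimensional ℝ W] in
/-- The word derivatives of the iterated time derivatives of a sequence in all classes `InB T l`
are uniformly Cauchy in the lifted (`cwd`) picture. [folklore] -/
theorem cwd_cauchy_of_inB {T : ℝ} (hB : ∀ l, InB T l U) (l : ℕ) :
    ∀ v : List (Fin 3), ∀ ε > (0 : ℝ), ∃ N : ℕ, ∀ k, N ≤ k → ∀ k', N ≤ k' → ∀ τ ∈ Icc (-T) T, ∀ y,
      ‖cwd v (lift ((timeDeriv^[l]) (U k) τ)) y - cwd v (lift ((timeDeriv^[l]) (U k') τ)) y‖ ≤ ε :=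
  cwd_iterate_cauchy_of_inB hB l

/-- **Majda's Theorem 2.1 on `𝕋³` in the `C^∞` class** (Dafermos, Thm 5.1.1, smooth periodic
data): for symmetrised quasilinear coefficient data and a smooth datum `U₀` there are `T > 0`
and a field `U` jointly `C^∞` on `(-T, T) × 𝕋³` with `U(0) = U₀` solving
`A₀(U)∂ₜU + ΣⱼAⱼ(U)∂ⱼU = 0` classically.
[cite: Majda1984, Ch. 2 §2.1, Thm 2.1; Dafermos2005, §5.1, Thm 5.1.1] -/
theorem exists_smooth_solution (h : IsQLSymmCoeff c₀ Λ₀ a0 a p q) (hU₀ : IsSmooth U₀) :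
    ∃ T : ℝ, 0 < T ∧ ∃ V : ℝ → UnitAddTorus (Fin 3) → W,
      IsSmoothSpaceTimeOn (Ioo (-T) T) V ∧ V 0 = U₀ ∧
      ∀ t ∈ Ioo (-T) T, ∀ x,
        a0 (V t x) (timeDeriv V t x) + ∑ j, a j (V t x) (partialDeriv j (V t) x) = 0 :=
  h.exists_smooth_solution_of_wordSup wordSupEmbedding_fin3_two hU₀

end IsQLSymmCoeff

end Limit

end Literature.Analysis.PDE

end
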